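import Mathlib
import Summits.QuantumFields.BalabanUV.Beta.UnitLatticeOmegaCells
import Summits.QuantumFields.BalabanUV.Beta.AnalyticWalkSum216RowResolvent

/-!
# `Summit.QuantumFields.BalabanUV.Beta.UnitLatticeOmegaBudgets` — A3-loc-ω: THE CREDITED BUDGETS `K₁″`, `Φ` OF THE
# Ω HAND-OFF FROM ONE LOCALISED PIECE BOUND in the row owner's (T3)-currency
# `Σ_l (Σ_ω e^{κ₁⁺·#cellsOf ω}·‖K_ω(k,l)‖)·e^{κ⁺d(k,l)} ≤ ρ` (`AnalyticWalkSum216RowResolvent.pieceMaj`, `DG := cellsOf`):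
# `K₁″ ≤ ρ/(e·(κ⁺ − κ′))` (one power of `d` costs the rate gap) and `Φ ≤ N·e^{−κ₂m₀}·ρ` (far pieces have `≥ m₀` cells and
# the weight margin `κ₂` per cell makes them small) — then the cell-currency hand-off with these budgets PLUGGED IN

HONEST FRAMING (page 1 of everything in this cell).  Discharging `FlowStep.BetaPertH` would make Bałaban's ultraviolet
stability UNCONDITIONAL — a constructive-QFT result; NOT the continuum limit, NOT the Clay problem.  This module
discharges nothing of `BetaPertH`; [folklore] bookkeeping, kernel-checked (unit `b2b-balaban-beta-d4-p3`, road P3, gen 5;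
skeleton v1.12 §7.9).  WHAT IT SETTLES (records): of the row owner's O.2 INTERFACE LIST (journal l.13075: (I3)∕(I4) «Ω-data
for the coarse pieces … + local inverses + level-X smallness») the Ω-DATA HALF is now ONE displayed bound of (T3)-shape on
the coarse pieces — the SAME currency his `AnalyticWalkSum216RowRegroup.regroup_bound` OUTPUTS for pieces regrouped by
dependence set — plus the far-family convention `hfar` (a piece outside `near b` that touches `supp h_b` has `≥ m₀`
cells) and numbers; no thread, no first-moment or far-mass hypothesis is left as a separate input.  HONEST COSTS, displayed:
the rate gap `κ⁺ > κ′ = κ + κ₁P/r` (one more rate loss, for the factor `d(k,l)` of the commutator gain) and the weight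
margin `κ₂` per cell (for the far mass) — both to be supplied by the upstream layer's (T3) bound, i.e. by running it at
`(κ⁺, κ₁ + κ₂)` instead of `(κ, κ₁)`: Bałaban's «δ₁M ≥ κ₁» (R1) and «M large» bookkeeping, nothing else.
HONEST DEPENDENCY: continuum YM on T⁴ ⇐ BetaPertH ∧ nine spine estimates (0/9 proved); BetaPertH ⇐
(D1) ∧ (D4) ∧ CAP+tail; G-an2-4 gates asym, D1 and NE2/3/4.

CITATION (locator only; nothing printed is used as a hypothesis).  [II] = T. Bałaban, *Renormalization group approach to
lattice gauge field theories. II. Cluster expansions*, Commun. Math. Phys. **116**, 1–22 (1988) [Balaban1988RG2Cluster],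
p. 5 (1.11) and the sentence after it («we can bound the expression under the supremum in (1.11) by 1, for δ₁M ≧ κ₁»),
quoted in full in `Literature.….B13WalkCubes111`'s header.  [13] = T. Bałaban, *Propagators for lattice gauge theories in a
background field*, Commun. Math. Phys. **99**, 389–434 (1985) [Balaban1985BackgroundPropagators], Thm 3.10 (3.108) p. 416
(the localised piece bound's shape).

CONTENTS (0 sorry).  §1 the scalar inequality `t ≤ e^{at}/(e·a)` and the two termwise comparisons.  §2 **`budgetK₁_of_pieceMaj`**,
**`budgetΦ_of_pieceMaj`** (the hand-off's `hK₁`, `hΦ` from the (T3)-shape bound, for ANY credit `cr` with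
`(κ₁P/r)·cr ω ≤ κ₁·#cellsOf ω` — equality for `UnitLatticeOmegaCells.crCells`).  §3 **`rowData_decFamilyΩ_pieceMaj`**: the
cell-currency hand-off `UnitLatticeOmegaCells.rowData_decFamilyΩ_cells` with `cr := crCells` and BOTH budgets discharged
from the one bound — hypotheses left: pseudo-metric, partition data, cells∕packing, row-locality + cell budget of the
pieces, `hfar`, the local-inverse budget `hL`, the ONE bound `hT`, and the smallness number
`C_L·((2N/M)·ρ/(e(κ⁺ − κ′)) + N·e^{−κ₂m₀}·ρ) < 1`; `crCells_nonneg'` for the row owner's `wrs_Rem₂_le`.  §4 non-vacuity.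
NOT HERE: the local inverses (abstract engine `UnitLatticeLocalInverse`; instance datum = coercivity), any instance on
Bałaban's operators ((T3), NODE O.2 untouched).  NOT summit progress.
-/

open scoped BigOperators Matrix
open Finset Matrix Metric

namespace Summit.QuantumFields.BalabanUV.Beta.UnitLatticeOmegaBudgets

open Summit.QuantumFields.BalabanUV.Beta.UnitLatticeWalkInversion
open Summit.QuantumFields.BalabanUV.Beta.UnitLatticeOmegaTerms
open Summit.QuantumFields.BalabanUV.Beta.UnitLatticeOmegaPaths
open Summit.QuantumFields.BalabanUV.Beta.UnitLatticeOmegaRowData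
open Summit.QuantumFields.BalabanUV.Beta.UnitLatticeOmegaCells
open Summit.QuantumFields.BalabanUV.Beta.AnalyticWalkSum216RowData (RowData)
open Summit.QuantumFields.BalabanUV.Beta.AnalyticWalkSum216RowResolvent (pieceMaj)
open Literature.MathematicalPhysics.QuantumFieldTheory.Balaban1983to89.B13PerturbativeStep (wrs WRS WeightHyp)

noncomputable section

variable {Y : Type*} [Fintype Y] [DecidableEq Y] {B Ω Δ : Type*} [Fintype Ω] [DecidableEq Ω]

/-! ## §1 Scalar and termwise comparisons -/

/-- `t ≤ e^{a·t}/(e·a)` for `a > 0` and every real `t` (from `x + 1 ≤ eˣ` at `x = at − 1`): one power of the distance costs the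
rate gap `a`. [folklore] -/
theorem le_exp_mul_div {a t : ℝ} (ha : 0 < a) : t ≤ Real.exp (a * t) / (Real.exp 1 * a) := by
  rw [le_div_iff₀ (by positivity)]
  have h := Real.add_one_le_exp (a * t - 1)
  have he : Real.exp (a * t - 1) * Real.exp 1 = Real.exp (a * t) := by rw [← Real.exp_add]; ring_nf
  calc t * (Real.exp 1 * a) = (a * t - 1 + 1) * Real.exp 1 := by ring
    _ ≤ Real.exp (a * t - 1) * Real.exp 1 := mul_le_mul_of_nonneg_right h (Real.exp_pos _).le
    _ = Real.exp (a * t) := he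

/-- **Termwise, first moment**: `‖K‖·d·e^{κ′d + δ·cr} ≤ (e(κ⁺ − κ′))⁻¹·(e^{w·m}·‖K‖·e^{κ⁺d})` when `δ·cr ≤ w·m`, `κ′ < κ⁺`
(any real `d`). [folklore] -/
theorem term_K₁_le {κ' κp δ cr w m dd nK : ℝ} (hκ : κ' < κp) (hn : 0 ≤ nK) (hcr : δ * cr ≤ w * m) :
    nK * dd * Real.exp (κ' * dd + δ * cr) ≤ (Real.exp 1 * (κp - κ'))⁻¹ * (Real.exp (w * m) * nK * Real.exp (κp * dd)) := by
  have hgap : 0 < κp - κ' := sub_pos.2 hκ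
  have h1 : dd ≤ Real.exp ((κp - κ') * dd) / (Real.exp 1 * (κp - κ')) := le_exp_mul_div hgap
  have h2 : Real.exp (δ * cr) ≤ Real.exp (w * m) := Real.exp_le_exp.2 hcr
  calc nK * dd * Real.exp (κ' * dd + δ * cr)
      = nK * (dd * (Real.exp (κ' * dd) * Real.exp (δ * cr))) := by rw [Real.exp_add]; ring
    _ ≤ nK * (Real.exp ((κp - κ') * dd) / (Real.exp 1 * (κp - κ')) * (Real.exp (κ' * dd) * Real.exp (w * m))) := by
        refine mul_le_mul_of_nonneg_left ?_ hn
        exact mul_le_mul h1 (mul_le_mul_of_nonneg_left h2 (Real.exp_pos _).le) (by positivity) (by positivity)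
    _ = (Real.exp 1 * (κp - κ'))⁻¹ * (Real.exp (w * m) * nK * (Real.exp ((κp - κ') * dd) * Real.exp (κ' * dd))) := by
        rw [div_eq_mul_inv]; ring
    _ = (Real.exp 1 * (κp - κ'))⁻¹ * (Real.exp (w * m) * nK * Real.exp (κp * dd)) := by
        rw [← Real.exp_add]; ring_nf

/-- **Termwise, far mass**: `F·‖K‖·e^{κ′d + δ·cr} ≤ N·e^{−κ₂m₀}·(e^{(w+κ₂)·m}·‖K‖·e^{κ⁺d})` when `0 ≤ F ≤ N`, `m₀ ≤ m`,
`δ·cr ≤ w·m`, `d ≥ 0`, `κ′ ≤ κ⁺`, `κ₂ ≥ 0`. [folklore] -/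
theorem term_Φ_le {κ' κp δ cr w κ₂ m m₀ dd nK F N : ℝ} (hκ : κ' ≤ κp) (hκ₂ : 0 ≤ κ₂) (hd : 0 ≤ dd) (hn : 0 ≤ nK)
    (hF0 : 0 ≤ F) (hFN : F ≤ N) (hm : m₀ ≤ m) (hcr : δ * cr ≤ w * m) :
    F * nK * Real.exp (κ' * dd + δ * cr)
      ≤ N * Real.exp (-(κ₂ * m₀)) * (Real.exp ((w + κ₂) * m) * nK * Real.exp (κp * dd)) := by
  have h1 : Real.exp (κ' * dd + δ * cr) ≤ Real.exp (-(κ₂ * m₀)) * (Real.exp ((w + κ₂) * m) * Real.exp (κp * dd)) := by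
    rw [← Real.exp_add, ← Real.exp_add]
    refine Real.exp_le_exp.2 ?_
    have h3 : κ' * dd ≤ κp * dd := mul_le_mul_of_nonneg_right hκ hd
    have h4 : κ₂ * m₀ ≤ κ₂ * m := mul_le_mul_of_nonneg_left hm hκ₂
    nlinarith
  have hN : 0 ≤ N := hF0.trans hFN
  calc F * nK * Real.exp (κ' * dd + δ * cr)
      ≤ N * nK * (Real.exp (-(κ₂ * m₀)) * (Real.exp ((w + κ₂) * m) * Real.exp (κp * dd))) :=
        mul_le_mul (mul_le_mul_of_nonneg_right hFN hn) h1 (Real.exp_pos _).le (mul_nonneg hN hn)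
    _ = N * Real.exp (-(κ₂ * m₀)) * (Real.exp ((w + κ₂) * m) * nK * Real.exp (κp * dd)) := by ring

/-! ## §2 The budgets from the localised piece bound -/

section Budgets

variable {d : Y → Y → ℝ}

omit [Fintype Y] [Fintype Ω] in
/-- The far indicator sum is between `0` and the overlap number: `0 ≤ Σ_b 1_{ω ∉ near b}|h_b(l)| ≤ #{b : l ∈ □̃_b} ≤ N`.
[folklore] -/
theorem farSum_le [Fintype B] (h : B → Y → ℝ) (E : B → Finset Y) (hsupp : ∀ b y, y ∉ E b → h b y = 0)
    (habs : ∀ b y, |h b y| ≤ 1) {N : ℝ} (hN : ∀ y, ((Finset.univ.filter fun b => y ∈ E b).card : ℝ) ≤ N)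
    (near : B → Finset Ω) (ω : Ω) (l : Y) :
    0 ≤ (∑ b, if ω ∈ near b then (0 : ℝ) else |h b l|) ∧ (∑ b, if ω ∈ near b then (0 : ℝ) else |h b l|) ≤ N := by
  classical
  refine ⟨Finset.sum_nonneg fun b _ => by split_ifs <;> simp [abs_nonneg], ?_⟩
  calc (∑ b, if ω ∈ near b then (0 : ℝ) else |h b l|)
      ≤ ∑ b, if l ∈ E b then (1 : ℝ) else 0 := Finset.sum_le_sum fun b _ => by
        by_cases hl : l ∈ E b
        · rw [if_pos hl]
          split_ifs
          · exact zero_le_one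
          · exact habs b l
        · rw [if_neg hl]
          split_ifs
          · exact le_rfl
          · rw [hsupp b l hl, abs_zero]
    _ = ((Finset.univ.filter fun b => l ∈ E b).card : ℝ) := by
        rw [Finset.card_filter]; push_cast; rfl
    _ ≤ N := hN l

omit [DecidableEq Y] [DecidableEq Ω] in
/-- **`hK₁` FROM THE (T3)-SHAPE BOUND.**  Rates `κ′ < κ⁺`; decoration weight `κ₁ ≤ w` per cell (`κ₂ := w − κ₁
≥ 0` is the spare margin, unused here); any credit with `δ·cr ω ≤ κ₁·#cellsOf ω`.  If
`∀ k, Σ_l (Σ_ω pieceMaj w K cellsOf ω (k,l))·e^{κ⁺d(k,l)} ≤ ρ` then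
`∀ k, Σ_ω Σ_l ‖K_ω(k,l)‖·d(k,l)·e^{κ′d(k,l) + δ·cr ω} ≤ ρ/(e·(κ⁺ − κ′))`. [cite: Balaban1988RG2Cluster, (1.11) p.5] -/
theorem budgetK₁_of_pieceMaj {κ' κp κ₁ w δ ρ : ℝ} (hκ : κ' < κp) (hw : κ₁ ≤ w)
    (K : Ω → Matrix Y Y ℂ) (cellsOf : Ω → Finset Δ) (cr : Ω → ℝ)
    (hcr : ∀ ω, δ * cr ω ≤ κ₁ * (cellsOf ω).card)
    (hT : ∀ k, ∑ l, (∑ ω, pieceMaj w K cellsOf ω k l) * Real.exp (κp * d k l) ≤ ρ) (k : Y) :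
    ∑ ω, ∑ l, ‖K ω k l‖ * d k l * Real.exp (κ' * d k l + δ * cr ω) ≤ (Real.exp 1 * (κp - κ'))⁻¹ * ρ := by
  have hgap : 0 < κp - κ' := sub_pos.2 hκ
  have hcr' : ∀ ω, δ * cr ω ≤ w * (cellsOf ω).card := fun ω =>
    (hcr ω).trans (mul_le_mul_of_nonneg_right hw (Nat.cast_nonneg _))
  calc ∑ ω, ∑ l, ‖K ω k l‖ * d k l * Real.exp (κ' * d k l + δ * cr ω)
      ≤ ∑ ω, ∑ l, (Real.exp 1 * (κp - κ'))⁻¹ * (pieceMaj w K cellsOf ω k l * Real.exp (κp * d k l)) :=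
        Finset.sum_le_sum fun ω _ => Finset.sum_le_sum fun l _ => by
          rw [pieceMaj]
          exact term_K₁_le hκ (norm_nonneg _) (hcr' ω)
    _ = (Real.exp 1 * (κp - κ'))⁻¹ * ∑ l, (∑ ω, pieceMaj w K cellsOf ω k l) * Real.exp (κp * d k l) := by
        rw [Finset.sum_comm, Finset.mul_sum]
        refine Finset.sum_congr rfl fun l _ => ?_
        rw [Finset.sum_mul, Finset.mul_sum]
    _ ≤ (Real.exp 1 * (κp - κ'))⁻¹ * ρ := mul_le_mul_of_nonneg_left (hT k) (by positivity)

/-- **`hΦ` FROM THE (T3)-SHAPE BOUND.**  Nonnegative `d`; `κ′ ≤ κ⁺`; decoration weight `w = κ₁ + κ₂` per cell with margin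
`κ₂ ≥ 0`; credit with `δ·cr ω ≤ κ₁·#cellsOf ω`; partition data (`supp h_b ⊆ □̃_b`, `|h| ≤ 1`, overlap `N`); THE FAR CONVENTION
`hfar`: a piece outside `near b` whose column index meets `supp h_b` has at least `m₀` cells.  Then
`∀ k, Σ_ω Σ_l (Σ_b 1_{ω∉near b}|h_b(l)|)·‖K_ω(k,l)‖·e^{κ′d + δ·cr ω} ≤ N·e^{−κ₂m₀}·ρ`. [cite: Balaban1988RG2Cluster, (1.11) p.5] -/
theorem budgetΦ_of_pieceMaj [Fintype B] (hd : ∀ a b, 0 ≤ d a b) {κ' κp κ₁ κ₂ δ ρ m₀ N : ℝ} (hκ : κ' ≤ κp)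
    (hκ₂ : 0 ≤ κ₂) (K : Ω → Matrix Y Y ℂ) (cellsOf : Ω → Finset Δ) (cr : Ω → ℝ)
    (hcr : ∀ ω, δ * cr ω ≤ κ₁ * (cellsOf ω).card) (h : B → Y → ℝ) (E : B → Finset Y)
    (hsupp : ∀ b y, y ∉ E b → h b y = 0) (habs : ∀ b y, |h b y| ≤ 1)
    (hN : ∀ y, ((Finset.univ.filter fun b => y ∈ E b).card : ℝ) ≤ N) (near : B → Finset Ω)
    (hfar : ∀ b ω k l, ω ∉ near b → h b l ≠ 0 → K ω k l ≠ 0 → m₀ ≤ (cellsOf ω).card)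
    (hT : ∀ k, ∑ l, (∑ ω, pieceMaj (κ₁ + κ₂) K cellsOf ω k l) * Real.exp (κp * d k l) ≤ ρ) (k : Y) :
    ∑ ω, ∑ l, (∑ b, if ω ∈ near b then (0 : ℝ) else |h b l|) * ‖K ω k l‖ * Real.exp (κ' * d k l + δ * cr ω)
      ≤ N * Real.exp (-(κ₂ * m₀)) * ρ := by
  classical
  have hN0 : 0 ≤ N := le_trans (Nat.cast_nonneg _) (hN k)
  have hterm : ∀ ω l, (∑ b, if ω ∈ near b then (0 : ℝ) else |h b l|) * ‖K ω k l‖ * Real.exp (κ' * d k l + δ * cr ω)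
      ≤ N * Real.exp (-(κ₂ * m₀)) * (pieceMaj (κ₁ + κ₂) K cellsOf ω k l * Real.exp (κp * d k l)) := by
    intro ω l
    obtain ⟨hF0, hFN⟩ := farSum_le h E hsupp habs hN near ω l
    set F := ∑ b, if ω ∈ near b then (0 : ℝ) else |h b l| with hF
    rw [pieceMaj]
    by_cases hK0 : K ω k l = 0
    · rw [hK0, norm_zero, mul_zero, zero_mul, mul_zero, zero_mul, mul_zero]
    by_cases hFz : F = 0
    · rw [hFz, zero_mul, zero_mul]
      positivity
    · -- some far cube touches `l`: the piece has at least `m₀` cells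
      have hm : m₀ ≤ (cellsOf ω).card := by
        have : ∃ b, (if ω ∈ near b then (0 : ℝ) else |h b l|) ≠ 0 := by
          by_contra hall
          exact hFz (Finset.sum_eq_zero fun b _ => not_ne_iff.1 (not_exists.1 hall b))
        obtain ⟨b, hb⟩ := this
        have hnb : ω ∉ near b := fun hmem => hb (by rw [if_pos hmem])
        have hhb : h b l ≠ 0 := fun h0 => hb (by rw [if_neg hnb, h0, abs_zero])
        exact hfar b ω k l hnb hhb hK0
      exact term_Φ_le hκ hκ₂ (hd k l) (norm_nonneg _) hF0 hFN hm (hcr ω)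
  calc ∑ ω, ∑ l, (∑ b, if ω ∈ near b then (0 : ℝ) else |h b l|) * ‖K ω k l‖ * Real.exp (κ' * d k l + δ * cr ω)
      ≤ ∑ ω, ∑ l, N * Real.exp (-(κ₂ * m₀)) * (pieceMaj (κ₁ + κ₂) K cellsOf ω k l * Real.exp (κp * d k l)) :=
        Finset.sum_le_sum fun ω _ => Finset.sum_le_sum fun l _ => hterm ω l
    _ = N * Real.exp (-(κ₂ * m₀)) * ∑ l, (∑ ω, pieceMaj (κ₁ + κ₂) K cellsOf ω k l) * Real.exp (κp * d k l) := by
        rw [Finset.sum_comm, Finset.mul_sum]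
        refine Finset.sum_congr rfl fun l _ => ?_
        rw [Finset.sum_mul, Finset.mul_sum]
    _ ≤ N * Real.exp (-(κ₂ * m₀)) * ρ := mul_le_mul_of_nonneg_left (hT k) (by positivity)

end Budgets

/-! ## §3 The hand-off with the budgets plugged in -/

section HandOff

variable [DecidableEq Δ] {κ : ℝ} {d : Y → Y → ℝ}

omit [Fintype Y] [DecidableEq Y] [Fintype Ω] [DecidableEq Ω] [DecidableEq Δ] in
/-- `crCells` credits satisfy the budget lemmas' credit condition with EQUALITY: `(κ₁P/r)·crCells ω ≤ κ₁·#cellsOf ω`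
(`P > 0`, `r ≠ 0`). [folklore] -/
theorem rate_crCells_le {κ₁ r : ℝ} (hr : r ≠ 0) {P : ℕ} (hP : 0 < P) (cellsOf : Ω → Finset Δ) (ω : Ω) :
    κ₁ * (P / r) * crCells r P cellsOf ω ≤ κ₁ * (cellsOf ω).card :=
  (rate_mul_crCells hr hP cellsOf ω).le

/-- **THE Ω HAND-OFF WITH ONE LOCALISED PIECE BOUND.**  Pseudo-metric `d` (`WeightHyp κ d`); partition data (supports `E b`
of diameter `≤ D`, `|h| ≤ 1`, Lipschitz `1/M`, overlap `N`); cells `cellOf` with packing `P > 0` at radius `R ≥ r + D`, `r > 0`;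
pieces `K_ω` row-local on `D_ω` with cell budgets `cellsOf ω ∋ cellOf z` for `z ∈ D_ω`; near families with the FAR
CONVENTION `hfar` (threshold `m₀`); near-local inverses `L_b` with budget `C_L` at rate `κ′ = κ + κ₁P/r`; and THE ONE BOUND
`hT : ∀ k, Σ_l (Σ_ω e^{(κ₁+κ₂)#cellsOf ω}‖K_ω(k,l)‖)·e^{κ⁺d(k,l)} ≤ ρ` at a rate `κ⁺ > κ′` with margin `κ₂`; smallness
`C_L·((2N/M)·ρ/(e(κ⁺ − κ′)) + N·e^{−κ₂m₀}·ρ) < 1`; frozen values `‖τ(Δ)‖ ≤ e^{κ₁}`, `κ₁ ≥ 0`.  THEN the fully decorated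
ω-family (credits `crCells`) with the coordinate `Δ₀` free is ROW DATA on `‖σ‖ < e^{κ₁}` at rate `κ` with majorant
`e^{κ₁P}·walkMajΩ (κ₁P/r)` and constant `e^{κ₁P}·N·C_L·(1 − ρ_Ω)⁻¹`, `ρ_Ω` the smallness number — volume-free.
[cite: Balaban1988RG2Cluster, (1.11) p.5] -/
theorem rowData_decFamilyΩ_pieceMaj [Fintype B] (hw : WeightHyp κ d)
    (K : Ω → Matrix Y Y ℂ) (Dω : Ω → Finset Y) (hK : ∀ ω k l, K ω k l ≠ 0 → k ∈ Dω ω) (near : B → Finset Ω)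
    (h : B → Y → ℝ) (E : B → Finset Y) (L : B → Matrix Y Y ℂ) (hsupp : ∀ b y, y ∉ E b → h b y = 0)
    (habs : ∀ b y, |h b y| ≤ 1) {M N C_L κ₁ κ₂ κp ρ m₀ r D R : ℝ} (hM : 0 < M)
    (hLip : ∀ b y y', |h b y - h b y'| ≤ d y y' / M) (hN : ∀ y, ((Finset.univ.filter fun b => y ∈ E b).card : ℝ) ≤ N)
    (hC : 0 ≤ C_L) (hκ₁ : 0 ≤ κ₁) (hr : 0 < r) (hRD : r + D ≤ R) (cellOf : Y → Δ) {P : ℕ} (hP : 0 < P)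
    (hpack : ∀ a : Y, ∃ S : Finset Δ, S.card ≤ P ∧ ∀ z, d a z ≤ R → cellOf z ∈ S)
    (hdiam : ∀ b, ∀ z ∈ E b, ∀ z' ∈ E b, d z z' ≤ D) (cellsOf : Ω → Finset Δ)
    (hcells : ∀ ω, ∀ z ∈ Dω ω, cellOf z ∈ cellsOf ω)
    (hfar : ∀ b ω k l, ω ∉ near b → h b l ≠ 0 → K ω k l ≠ 0 → m₀ ≤ (cellsOf ω).card)
    (hL : ∀ b, WRS (κ + κ₁ * (P / r)) d (L b) C_L) (hκp : κ + κ₁ * (P / r) < κp) (hκ₂ : 0 ≤ κ₂)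
    (hT : ∀ k, ∑ l, (∑ ω, pieceMaj (κ₁ + κ₂) K cellsOf ω k l) * Real.exp (κp * d k l) ≤ ρ)
    (hρ : C_L * (2 * N / M * ((Real.exp 1 * (κp - (κ + κ₁ * (P / r))))⁻¹ * ρ) + N * Real.exp (-(κ₂ * m₀)) * ρ) < 1)
    (τ : Δ → ℂ) (hτ : ∀ δ, ‖τ δ‖ ≤ Real.exp κ₁) (Δ₀ : Δ) :
    RowData κ d (Real.exp κ₁) (decFamilyΩ cellOf E Dω h K near L τ Δ₀)
      (decMajΩ (Real.exp (κ₁ * P)) (κ₁ * (P / r)) d (crCells r P cellsOf) h K near L)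
      (Real.exp (κ₁ * P) * (N * C_L) * (1 - C_L * (2 * N / M * ((Real.exp 1 * (κp - (κ + κ₁ * (P / r))))⁻¹ * ρ)
        + N * Real.exp (-(κ₂ * m₀)) * ρ))⁻¹) := by
  have hcr : ∀ ω, κ₁ * (P / r) * crCells r P cellsOf ω ≤ κ₁ * ((cellsOf ω).card : ℝ) := fun ω =>
    rate_crCells_le hr.ne' hP cellsOf ω
  have hK1 : ∀ k, ∑ ω, ∑ l, ‖K ω k l‖ * d k l
      * Real.exp ((κ + κ₁ * (P / r)) * d k l + κ₁ * (P / r) * crCells r P cellsOf ω)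
        ≤ (Real.exp 1 * (κp - (κ + κ₁ * (P / r))))⁻¹ * ρ :=
    budgetK₁_of_pieceMaj hκp (le_add_of_nonneg_right hκ₂) K cellsOf (crCells r P cellsOf) hcr hT
  have hPhi : ∀ k, ∑ ω, ∑ l, (∑ b, if ω ∈ near b then (0 : ℝ) else |h b l|) * ‖K ω k l‖
      * Real.exp ((κ + κ₁ * (P / r)) * d k l + κ₁ * (P / r) * crCells r P cellsOf ω) ≤ N * Real.exp (-(κ₂ * m₀)) * ρ :=
    budgetΦ_of_pieceMaj hw.nonneg hκp.le hκ₂ K cellsOf (crCells r P cellsOf) hcr h E hsupp habs hN near hfar hT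
  exact rowData_decFamilyΩ_cells hw K Dω hK near h E L hsupp habs hM hLip hN hC hκ₁ hr hRD cellOf hpack hdiam cellsOf
    hcells (crCells r P cellsOf) (fun ω => crCells_spec hP cellsOf ω) hL hK1 hPhi hρ τ hτ Δ₀

omit [Fintype Y] [DecidableEq Y] [Fintype Ω] [DecidableEq Ω] [DecidableEq Δ] in
/-- For the row owner's `wrs_Rem₂_le` (which wants nonnegative credits): `crCells ≥ 0`. [folklore] -/
theorem crCells_nonneg' {r : ℝ} (hr : 0 < r) (P : ℕ) (cellsOf : Ω → Finset Δ) (ω : Ω) :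
    0 ≤ crCells r P cellsOf ω :=
  crCells_nonneg hr.le P cellsOf ω

end HandOff

/-! ## §4 Non-vacuity -/

section Witness

open Summit.QuantumFields.BalabanUV.Beta.UnitLatticeOmegaWitness (d0 h1 E1 K0 near0 L1 Dω0 weightHyp_zero wrs_L1)

/-- **NON-VACUITY**: the conclusion of `rowData_decFamilyΩ_pieceMaj` is inhabited on the one-site data of
`UnitLatticeOmegaWitness` (zero pieces, empty cell budgets, `ρ = 0`, `m₀ = 0`, `κ₂ = 0`, `κ⁺ = 2 > κ′ = 1`) — obtained by
APPLYING the theorem with every binder discharged. [folklore] -/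
theorem rowData_pieceMaj_witness :
    RowData 0 d0 (Real.exp 1) (decFamilyΩ (fun y : Fin 1 => y) E1 Dω0 h1 K0 near0 L1 (fun _ => (1 : ℂ)) 0)
      (decMajΩ (Real.exp (1 * (1 : ℕ))) (1 * ((1 : ℕ) / 1)) d0 (crCells 1 1 cells0) h1 K0 near0 L1)
      (Real.exp (1 * (1 : ℕ)) * (1 * 1) * (1 - 1 * (2 * 1 / 1 * ((Real.exp 1 * (2 - (0 + 1 * ((1 : ℕ) / 1))))⁻¹ * 0)
        + 1 * Real.exp (-(0 * 0)) * 0))⁻¹) := by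
  refine rowData_decFamilyΩ_pieceMaj (κ := 0) (weightHyp_zero le_rfl) K0 Dω0 (fun ω k l hk => ?_) near0 h1 E1
    L1 (fun b y hy => absurd (Finset.mem_univ y) hy) (fun b y => by simp [h1]) (M := 1) (N := 1) (C_L := 1)
    (κ₁ := 1) (κ₂ := 0) (κp := 2) (ρ := 0) (m₀ := 0) (r := 1) (D := 0) (R := 1) one_pos
    (fun b y y' => by simp [h1, d0]) (fun y => ?_) zero_le_one zero_le_one one_pos (by norm_num) (fun y : Fin 1 => y)
    (P := 1) one_pos (fun a => ?_) (fun b z _ z' _ => le_of_eq rfl) cells0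
    (fun ω z hz => absurd hz (Finset.notMem_empty z)) (fun b ω k l _ _ hk => ?_) (fun b => ?_) (by norm_num) le_rfl
    (fun k => ?_) (by norm_num) (fun _ => (1 : ℂ)) (fun δ => by rw [norm_one]; exact (Real.one_lt_exp_iff.2 one_pos).le) 0
  · simp [K0] at hk
  · have hc := Finset.card_filter_le (Finset.univ : Finset (Fin 1)) (fun b => y ∈ E1 b)
    rw [Finset.card_univ, Fintype.card_fin] at hc
    exact_mod_cast hc
  · exact ⟨Finset.univ, by simp, fun z _ => Finset.mem_univ _⟩
  · simp [K0] at hk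
  · simpa using wrs_L1 (κ := 0 + 1 * ((1 : ℕ) / 1)) (by norm_num) b
  · simp [pieceMaj, K0]

end Witness

end

end Summit.QuantumFields.BalabanUV.Beta.UnitLatticeOmegaBudgets
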